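import Summits.RiemannHypothesis.RiemannHypothesis.Theses.SignCone
import Summits.RiemannHypothesis.RiemannHypothesis.Theorems.SignConeSignConeOscillatoryUpToThirteenTenths
import HarnessLib

/-!
# RiemannHypothesis / SignCone — support item `OscUpToThirteenTenths`

Route `RiemannHypothesis/SignCone`, item `stmt-RiemannHypothesis-18011` (support, binder `hR` of the
route's deciding theorem `closes`): the oscillatory case of the unit-slack sign-cone inequality,
UNCONDITIONALLY, for every cut-off `0 < a ≤ 13/10` — for every finite family of Weil tests `gᵢ`
supported in `[-a, a]` with `F = Σᵢ gᵢ ⋆ g̃ᵢ` node-nonnegative (`0 ≤ Re F (log n)`, `n ≥ 2`) and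
negative somewhere on the far field `|t| ≥ log 2`, one has `-Re F(0) ≤ Re W_ar(F)` with the
archimedean-plus-polar Weil functional written out through the Mellin–Laplace transform `M`.

The statement is, byte for byte, the type of the landed theorem
`SignCone.signConeOscillatory_upTo_thirteen_tenths`
(`Theorems/SignConeSignConeOscillatoryUpToThirteenTenths.lean`), which rests on the kernel-checked
pointwise dual certificate `pwCert13s` (fake weights `c_n = a_n √n / 2` on `n = 3, …, 12`, density
`0 ≤ Re ψ(1/4 + iy/2) − log π + 1 + Ê_χ(y) − Σ_n a_n cos(y log n)` for every real `y`) and the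
spectral identity `slackFunctional_eq_spectralIntegral`. This file closes the item by that theorem.
-/

-- `Summit.RiemannHypothesis.RiemannHypothesis.…` repeats a namespace component by design (D-0017 layout).
set_option linter.dupNamespace false

namespace Summit.RiemannHypothesis.RiemannHypothesis.Theorems

/-- **Item `stmt-RiemannHypothesis-18011` (`SignCone.OscUpToThirteenTenths`).** For every cut-off
`0 < a ≤ 13/10`, every finite family of smooth compactly supported tests `gᵢ` with
`tsupport gᵢ ⊆ [-a, a]`, and `F = Σᵢ gᵢ ⋆ (conj ∘ gᵢ ∘ Neg.neg)` node-nonnegative and negative at some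
`|t| ≥ log 2`: `-Re F(0) ≤ Re (M 0 + M 1 + (1/2π) ∫ M(1/2 + it) Re ψ(1/4 + it/2) dt − F(0) log π)`,
`M s = ∫ F(u) e^{(s - 1/2) u} du`. Immediate from the landed rung
`SignCone.signConeOscillatory_upTo_thirteen_tenths` (kernel-checked dual certificate `pwCert13s`).
[folklore] -/
theorem oscUpToThirteenTenths_proof :
    Summit.RiemannHypothesis.RiemannHypothesis.Theses.SignCone.OscUpToThirteenTenths := by
  unfold Summit.RiemannHypothesis.RiemannHypothesis.Theses.SignCone.OscUpToThirteenTenths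
  exact SignCone.signConeOscillatory_upTo_thirteen_tenths

end Summit.RiemannHypothesis.RiemannHypothesis.Theorems
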